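import Summits.CriticalPhenomena.PercolationContinuityZ3.Theorems.Transplant.FKConnectivityAllQAntipodalX2WordsSolitonRows
import HarnessLib

/-!
# Connectivity correlation inequalities for `φ_{w,q}` — the TYPE-WORD MODEL of `X2`, file 9: the SOLITON SHIFT (memo g13 §4,
# pairings (P1)–(P4))

Helper file (`--supports stmt-CriticalPhenomena-4575`), FK sub-lane `prim-bschramm-fk-2` (gen 13); builds on p205010 (kernel
theorem, internal audit signed; external expert review pending).  Pure finite combinatorics on the type-word model of
`…AntipodalX2Words` (memo `bschramm/FROM-fk-2-g13-WORD-HALL.md`).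
* the five pattern identities `swapWin_soliton_*`, `swapWin_ground` (the window swap of a soliton word is the shifted soliton word);
* `soliton_pair_W_pos` `Σ_W(i,m) ↦ Σ_P(i+1,m)` (`i ≥ 1`), `soliton_pair_P_ge2` `Σ_P(i,m) ↦ Σ_W(i-1,m)` (`i ≥ 2`), `soliton_pair_W_zero`
  `Σ_W(0,m) ↦ Σ_P(1,m-1)`, `soliton_pair_P_one` `Σ_P(1,m) ↦ Σ_W(0,m+1)`, `soliton_pair_W_zero_zero` `Σ_W(0,0) ↦ ground`,
  `ground_pair_W`, `ground_fixed_P`: in each case the partner is a loser of the same level with the same RULE-N window.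
[cite: Grimmett2006, §3.9 (p. 63)]
-/

namespace Summit.CriticalPhenomena.PercolationContinuityZ3.Theorems

namespace FK

namespace X2Word

/-! ### The soliton shift: the five pattern identities -/

section Shift

/-- `Σ_W(i,m) ↦ Σ_P(i+1,m)`: swapping the window `[i, i+2m+1]`. [folklore] -/
theorem swapWin_soliton_right (n i m : ℕ) :
    swapWin i (i + 2 * m + 1) (solitonPattern n i m) = solitonPattern n (i + 1) m := by
  apply List.ext_getElem (by simp)
  intro j h1 h2
  rw [getElem_swapWin, getElem_solitonPattern, getElem_solitonPattern]
  split_ifs <;> first | rfl | (exfalso; omega)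

/-- `Σ_P(i,m) ↦ Σ_W(i-1,m)` (`i ≥ 1`): swapping the window `[i-1, i+2m]`. [folklore] -/
theorem swapWin_soliton_left (n i m : ℕ) (hi : 1 ≤ i) :
    swapWin (i - 1) (i + 2 * m) (solitonPattern n i m) = solitonPattern n (i - 1) m := by
  apply List.ext_getElem (by simp)
  intro j h1 h2
  rw [getElem_swapWin, getElem_solitonPattern, getElem_solitonPattern]
  split_ifs <;> first | rfl | (exfalso; omega)

/-- `Σ_W(0,m) ↦ Σ_P(1,m-1)` (`m ≥ 1`): swapping the window `[0, 2m]`. [folklore] -/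
theorem swapWin_soliton_zero (n m : ℕ) (hm : 1 ≤ m) :
    swapWin 0 (2 * m) (solitonPattern n 0 m) = solitonPattern n 1 (m - 1) := by
  apply List.ext_getElem (by simp)
  intro j h1 h2
  rw [getElem_swapWin, getElem_solitonPattern, getElem_solitonPattern]
  split_ifs <;> first | rfl | (exfalso; omega)

/-- `Σ_P(1,m) ↦ Σ_W(0,m+1)`: swapping the window `[0, 2m+2]`. [folklore] -/
theorem swapWin_soliton_one (n m : ℕ) :
    swapWin 0 (2 * m + 2) (solitonPattern n 1 m) = solitonPattern n 0 (m + 1) := by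
  apply List.ext_getElem (by simp)
  intro j h1 h2
  rw [getElem_swapWin, getElem_solitonPattern, getElem_solitonPattern]
  split_ifs <;> first | rfl | (exfalso; omega)

/-- `Σ_W(0,0) ↦ ground`: swapping the window `[0, 0]`. [folklore] -/
theorem swapWin_soliton_zero_zero (n : ℕ) : swapWin 0 0 (solitonPattern n 0 0) = List.replicate n .E := by
  apply List.ext_getElem (by simp)
  intro j h1 h2
  rw [getElem_swapWin, getElem_solitonPattern, List.getElem_replicate]
  split_ifs <;> first | rfl | (exfalso; omega)

/-- `ground ↦ Σ_W(0,0)`: swapping the window `[0, 0]` of the ground word. [folklore] -/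
theorem swapWin_ground (n : ℕ) : swapWin 0 0 (List.replicate n .E) = solitonPattern n 0 0 := by
  rw [← swapWin_soliton_zero_zero n, swapWin_swapWin]

end Shift


/-! ### THEOREM A on soliton and ground words (memo g13 §4) -/

section SolitonPairs

variable {k₀ : Kind}

/-- RULE N on the ground word. [folklore] -/
theorem ruleN_replicate (k₀ : Kind) (n : ℕ) :
    ruleN k₀ (List.replicate n .E) = (match k₀ with | .W => some (0, 0) | .P => none) := by
  have hs : hullStart (List.replicate n Ty.E) = none := (hullStart_eq_none_iff _).mpr (by simp)
  have he : hullEnd (List.replicate n Ty.E) = none := (hullEnd_eq_none_iff _).mpr (by simp)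
  cases k₀ <;> simp [ruleN, hs, he]

/-- (P1) `Σ_W(i,m)`, `i ≥ 1`: the partner is `Σ_P(i+1,m)`, a loser of the same level with the same window. [folklore] -/
theorem soliton_pair_W_pos {n i m : ℕ} (hk : kindAt k₀ i = .W) (hi : 1 ≤ i) (hlos : i + 2 * m + 1 < n) :
    iota k₀ (solitonPattern n i m) = solitonPattern n (i + 1) m ∧
    isLoser k₀ (solitonPattern n (i + 1) m) = true ∧
    level k₀ (solitonPattern n (i + 1) m) = level k₀ (solitonPattern n i m) ∧
    ruleN k₀ (solitonPattern n (i + 1) m) = ruleN k₀ (solitonPattern n i m) := by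
  have hk1 : kindAt k₀ (i + 1) = .P := by rw [kindAt_succ, hk]; rfl
  have hr0 := ruleN_solitonPattern (k₀ := k₀) (show i + 2 * m < n by omega)
  have hr1 := ruleN_solitonPattern (k₀ := k₀) (show i + 1 + 2 * m < n by omega)
  obtain ⟨hl0, hv0⟩ := soliton_W_loser_level (k₀ := k₀) (show i + 2 * m < n by omega) hk
  obtain ⟨hl1, hv1⟩ := soliton_P_loser_level (k₀ := k₀) (show i + 1 + 2 * m < n by omega) hk1
  refine ⟨?_, ?_, ?_, ?_⟩
  · unfold iota; rw [hr0, hk]; simp only [solitonWindow, show i ≠ 0 by omega, if_false]; exact swapWin_soliton_right n i m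
  · rw [hl1]; simp; omega
  · rw [hv1 ⟨by omega, Or.inl (by omega)⟩, hv0 hlos]; simp [hi]
  · rw [hr0, hr1, hk, hk1]; simp [solitonWindow, show i ≠ 0 by omega]; omega

/-- (P1') `Σ_P(i,m)`, `i ≥ 2`: the partner is `Σ_W(i-1,m)`. [folklore] -/
theorem soliton_pair_P_ge2 {n i m : ℕ} (hk : kindAt k₀ i = .P) (hi : 2 ≤ i) (hn : i + 2 * m < n) :
    iota k₀ (solitonPattern n i m) = solitonPattern n (i - 1) m ∧
    isLoser k₀ (solitonPattern n (i - 1) m) = true ∧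
    level k₀ (solitonPattern n (i - 1) m) = level k₀ (solitonPattern n i m) ∧
    ruleN k₀ (solitonPattern n (i - 1) m) = ruleN k₀ (solitonPattern n i m) := by
  have hk1 : kindAt k₀ (i - 1) = .W := by rw [kindAt_pred (by omega), hk]; rfl
  have hr0 := ruleN_solitonPattern (k₀ := k₀) hn
  have hr1 := ruleN_solitonPattern (k₀ := k₀) (show i - 1 + 2 * m < n by omega)
  obtain ⟨hl0, hv0⟩ := soliton_P_loser_level (k₀ := k₀) hn hk
  obtain ⟨hl1, hv1⟩ := soliton_W_loser_level (k₀ := k₀) (show i - 1 + 2 * m < n by omega) hk1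
  refine ⟨?_, ?_, ?_, ?_⟩
  · unfold iota; rw [hr0, hk]; simp only [solitonWindow, show ¬ i ≤ 1 by omega, if_false]; exact swapWin_soliton_left n i m (by omega)
  · rw [hl1]; simp; omega
  · rw [hv1 (by omega), hv0 ⟨by omega, Or.inl hi⟩]; simp [show 1 ≤ i - 1 by omega]
  · rw [hr0, hr1, hk, hk1]; simp [solitonWindow, show ¬ i ≤ 1 by omega, show i - 1 ≠ 0 by omega]; omega

/-- (P2) `Σ_W(0,m)`, `m ≥ 1` (so `k₀ = W`): the partner is `Σ_P(1,m-1)`. [folklore] -/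
theorem soliton_pair_W_zero {n m : ℕ} (hk : k₀ = .W) (hm : 1 ≤ m) (hlos : 2 * m + 1 < n) :
    iota k₀ (solitonPattern n 0 m) = solitonPattern n 1 (m - 1) ∧
    isLoser k₀ (solitonPattern n 1 (m - 1)) = true ∧
    level k₀ (solitonPattern n 1 (m - 1)) = level k₀ (solitonPattern n 0 m) ∧
    ruleN k₀ (solitonPattern n 1 (m - 1)) = ruleN k₀ (solitonPattern n 0 m) := by
  subst hk
  have hk0 : kindAt Kind.W 0 = .W := rfl
  have hk1 : kindAt Kind.W 1 = .P := rfl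
  have hr0 := ruleN_solitonPattern (k₀ := .W) (show 0 + 2 * m < n by omega)
  have hr1 := ruleN_solitonPattern (k₀ := .W) (show 1 + 2 * (m - 1) < n by omega)
  obtain ⟨hl0, hv0⟩ := soliton_W_loser_level (k₀ := .W) (show 0 + 2 * m < n by omega) hk0
  obtain ⟨hl1, hv1⟩ := soliton_P_loser_level (k₀ := .W) (show 1 + 2 * (m - 1) < n by omega) hk1
  refine ⟨?_, ?_, ?_, ?_⟩
  · unfold iota; rw [hr0, hk0]; simp only [solitonWindow, if_true, show m ≠ 0 by omega, if_false]; exact swapWin_soliton_zero n m hm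
  · rw [hl1]; simp; omega
  · rw [hv1 ⟨le_refl 1, Or.inr (by omega)⟩, hv0 (by omega)]; simp; omega
  · rw [hr0, hr1, hk0, hk1]; simp [solitonWindow, show m ≠ 0 by omega]; omega

/-- (P2') `Σ_P(1,m)` (so `k₀ = W`): the partner is `Σ_W(0,m+1)`. [folklore] -/
theorem soliton_pair_P_one {n m : ℕ} (hk : k₀ = .W) (hlos : 2 * m + 3 < n) :
    iota k₀ (solitonPattern n 1 m) = solitonPattern n 0 (m + 1) ∧
    isLoser k₀ (solitonPattern n 0 (m + 1)) = true ∧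
    level k₀ (solitonPattern n 0 (m + 1)) = level k₀ (solitonPattern n 1 m) ∧
    ruleN k₀ (solitonPattern n 0 (m + 1)) = ruleN k₀ (solitonPattern n 1 m) := by
  subst hk
  have hk0 : kindAt Kind.W 0 = .W := rfl
  have hk1 : kindAt Kind.W 1 = .P := rfl
  have hr0 := ruleN_solitonPattern (k₀ := .W) (show 1 + 2 * m < n by omega)
  have hr1 := ruleN_solitonPattern (k₀ := .W) (show 0 + 2 * (m + 1) < n by omega)
  obtain ⟨hl0, hv0⟩ := soliton_P_loser_level (k₀ := .W) (show 1 + 2 * m < n by omega) hk1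
  obtain ⟨hl1, hv1⟩ := soliton_W_loser_level (k₀ := .W) (show 0 + 2 * (m + 1) < n by omega) hk0
  refine ⟨?_, ?_, ?_, ?_⟩
  · unfold iota; rw [hr0, hk1]; simp only [solitonWindow, le_refl, if_true]; exact swapWin_soliton_one n m
  · rw [hl1]; simp; omega
  · rw [hv1 (by omega), hv0 ⟨le_refl 1, Or.inr (by omega)⟩]; simp
  · rw [hr0, hr1, hk0, hk1]; simp [solitonWindow]; omega

/-- (P3) `Σ_W(0,0)` (so `k₀ = W`): the partner is the ground word. [folklore] -/
theorem soliton_pair_W_zero_zero {n : ℕ} (hk : k₀ = .W) (hlos : 1 < n) :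
    iota k₀ (solitonPattern n 0 0) = List.replicate n .E ∧
    isLoser k₀ (List.replicate n .E) = true ∧
    level k₀ (List.replicate n .E) = level k₀ (solitonPattern n 0 0) ∧
    ruleN k₀ (List.replicate n .E) = ruleN k₀ (solitonPattern n 0 0) := by
  subst hk
  have hk0 : kindAt Kind.W 0 = .W := rfl
  have hr0 := ruleN_solitonPattern (k₀ := .W) (show 0 + 2 * 0 < n by omega)
  obtain ⟨hl0, hv0⟩ := soliton_W_loser_level (k₀ := .W) (show 0 + 2 * 0 < n by omega) hk0
  obtain ⟨hl1, hv1⟩ := ground_loser_level Kind.W n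
  refine ⟨?_, ?_, ?_, ?_⟩
  · unfold iota; rw [hr0, hk0]; simp only [solitonWindow, if_true]; exact swapWin_soliton_zero_zero n
  · rw [hl1]; simp; omega
  · rw [hv1 (by omega), hv0 (by omega)]; simp
  · rw [hr0, hk0, ruleN_replicate]; simp [solitonWindow]

/-- (P3') the ground word with `k₀ = W` (a loser iff `n ≥ 2`): the partner is `Σ_W(0,0)`. [folklore] -/
theorem ground_pair_W {n : ℕ} (hlos : 1 < n) :
    iota .W (List.replicate n .E) = solitonPattern n 0 0 ∧
    isLoser .W (solitonPattern n 0 0) = true ∧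
    level .W (solitonPattern n 0 0) = level .W (List.replicate n .E) ∧
    ruleN .W (solitonPattern n 0 0) = ruleN .W (List.replicate n .E) := by
  obtain ⟨h1, h2, h3, h4⟩ := soliton_pair_W_zero_zero (k₀ := .W) rfl hlos
  obtain ⟨hl0, -⟩ := soliton_W_loser_level (k₀ := .W) (show 0 + 2 * 0 < n by omega) rfl
  refine ⟨?_, ?_, h3.symm, h4.symm⟩
  · unfold iota; rw [ruleN_replicate]; exact swapWin_ground n
  · rw [hl0]; simp; omega

/-- (P4) the ground word with `k₀ = P` is the fixed point of RULE N. [folklore] -/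
theorem ground_fixed_P (n : ℕ) : iota .P (List.replicate n .E) = List.replicate n .E := by
  unfold iota; rw [ruleN_replicate]

end SolitonPairs

end X2Word

end FK

end Summit.CriticalPhenomena.PercolationContinuityZ3.Theorems
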